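import Mathlib
import HarnessLib

/-!
# Sylvester–Hermite: the trace form of `ℝ[t]/(g)` is positive semidefinite when `g` is real rooted

Topic `Literature/FieldTheory/RealClosed`. The positive-semidefiniteness half of the classical
real root counting by the trace form (J. J. Sylvester 1853, C. Hermite 1856), in the form quoted
by C. Hanselka, J. Algebra 487 (2017) 340–356, **Lemma 1.1 (Sylvester)** ("the signature of the
trace form of `K[t]/(f)` over `K` is the number of distinct roots of `f` that lie in `R`") and
**Corollary 3.1** ("`f` is real rooted in `P` iff `τ ⊗ R(P)` is positive semidefinite"), here over
`ℝ` and in the direction used in Hanselka's proof of the Helton–Vinnikov theorem (§§3, 5: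
positivity of scaled trace forms at real points):

* `trace_mul_self_nonneg_of_card_roots_eq` — if `g ∈ ℝ[t]` is monic with all its roots real
  (`card g.roots = deg g`), then `Tr_{(ℝ[t]/(g))/ℝ}(u²) ≥ 0` for every `u ∈ ℝ[t]/(g)`.

Proof: induction on `deg g` through the Chinese remainder theorem
`ℝ[t]/(g) ≅ ℝ[t]/((t−c)^m) × ℝ[t]/(h)` (`c` a root of multiplicity `m`, `h(c) ≠ 0`), additivity of
the trace on products, and the local computation `Tr_{ℝ[t]/((t−c)^m)}(u²) = m·u(c)² ≥ 0`
(`u = u(c) + nilpotent`, traces of nilpotents vanish) — i.e. `Tr(u²) = Σ_λ m_λ u(λ)²`.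

## References

* [Hanselka2017] C. Hanselka, J. Algebra 487 (2017) 340–356: Lemma 1.1 (Sylvester), Cor. 3.1.
* C. Hermite, *Sur le nombre des racines d'une équation algébrique comprises entre des limites
  données*, J. reine angew. Math. 52 (1856); J. J. Sylvester, Phil. Trans. 143 (1853).
-/

noncomputable section

open Polynomial

namespace Literature.FieldTheory.RealClosed

/-- `ℝ[t]/(g)` for a monic `g` is free of finite rank over `ℝ` (power basis). [folklore] -/
theorem free_and_finite_adjoinRoot {g : ℝ[X]} (hg : g.Monic) :
    Module.Free ℝ (AdjoinRoot g) ∧ Module.Finite ℝ (AdjoinRoot g) :=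
  ⟨Module.Free.of_basis (AdjoinRoot.powerBasis' hg).basis,
    Module.Finite.of_basis (AdjoinRoot.powerBasis' hg).basis⟩

/-- **Local case.** In `ℝ[t]/((t − c)^m)` every element is `u(c) + (nilpotent)`, so
`Tr(u²) = m · u(c)² ≥ 0`. [folklore] -/
theorem trace_mul_self_nonneg_local (c : ℝ) (m : ℕ) (u : AdjoinRoot ((X - C c) ^ m)) :
    0 ≤ Algebra.trace ℝ (AdjoinRoot ((X - C c) ^ m)) (u * u) := by
  have hmon : ((X - C c) ^ m).Monic := (monic_X_sub_C c).pow m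
  haveI := (free_and_finite_adjoinRoot hmon).1
  haveI := (free_and_finite_adjoinRoot hmon).2
  obtain ⟨p, rfl⟩ := AdjoinRoot.mk_surjective u
  obtain ⟨q, hq⟩ := (X_sub_C_dvd_sub_C_eval : X - C c ∣ p - C (p.eval c))
  set w : AdjoinRoot ((X - C c) ^ m) := AdjoinRoot.mk _ ((X - C c) * q) with hw
  have hwnil : IsNilpotent w := by
    refine ⟨m, ?_⟩
    rw [hw, ← map_pow, mul_pow, AdjoinRoot.mk_eq_zero]
    exact Dvd.intro _ rfl
  have hp : p = C (p.eval c) + (X - C c) * q := by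
    rw [← hq]
    ring
  have hu : AdjoinRoot.mk ((X - C c) ^ m) p =
      algebraMap ℝ (AdjoinRoot ((X - C c) ^ m)) (p.eval c) + w := by
    conv_lhs => rw [hp]
    rw [map_add, AdjoinRoot.algebraMap_eq, AdjoinRoot.mk_C]
  set e : ℝ := p.eval c
  have hsq : AdjoinRoot.mk ((X - C c) ^ m) p * AdjoinRoot.mk ((X - C c) ^ m) p =
      algebraMap ℝ _ (e * e) + w * (2 * algebraMap ℝ _ e + w) := by
    rw [hu, map_mul]
    ring
  have hnil : IsNilpotent (w * (2 * algebraMap ℝ (AdjoinRoot ((X - C c) ^ m)) e + w)) :=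
    (Commute.all _ _).isNilpotent_mul_right hwnil
  have htr0 : Algebra.trace ℝ _ (w * (2 * algebraMap ℝ (AdjoinRoot ((X - C c) ^ m)) e + w)) = 0 :=
    (Algebra.isNilpotent_trace_of_isNilpotent hnil).eq_zero
  rw [hsq, map_add, htr0, add_zero, Algebra.trace_algebraMap, nsmul_eq_mul]
  exact mul_nonneg (Nat.cast_nonneg _) (mul_self_nonneg e)

/-- **Chinese remainder step for the trace form.** For coprime monic `g₁, g₂ ∈ ℝ[t]` with
`g₁ g₂ = g`, the trace of `u²` on `ℝ[t]/(g)` is the sum of the traces of the squares of the two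
components of `u`. [folklore] -/
theorem trace_mul_self_eq_add_of_isCoprime {g g₁ g₂ : ℝ[X]} (hg₁ : g₁.Monic) (hg₂ : g₂.Monic)
    (hcop : IsCoprime g₁ g₂) (hg : g₁ * g₂ = g) (u : AdjoinRoot g) :
    ∃ (u₁ : AdjoinRoot g₁) (u₂ : AdjoinRoot g₂),
      Algebra.trace ℝ (AdjoinRoot g) (u * u) =
        Algebra.trace ℝ (AdjoinRoot g₁) (u₁ * u₁) + Algebra.trace ℝ (AdjoinRoot g₂) (u₂ * u₂) := by
  haveI := (free_and_finite_adjoinRoot hg₁).1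
  haveI := (free_and_finite_adjoinRoot hg₁).2
  haveI := (free_and_finite_adjoinRoot hg₂).1
  haveI := (free_and_finite_adjoinRoot hg₂).2
  -- the ideals
  have hIJ : IsCoprime (Ideal.span {g₁}) (Ideal.span {g₂} : Ideal ℝ[X]) :=
    (Ideal.isCoprime_span_singleton_iff g₁ g₂).mpr hcop
  have hspan : (Ideal.span {g} : Ideal ℝ[X]) = Ideal.span {g₁} ⊓ Ideal.span {g₂} := by
    rw [← Ideal.mul_eq_inf_of_isCoprime hIJ, Ideal.span_singleton_mul_span_singleton, hg]
  -- CRT as an `ℝ`-algebra isomorphism `AdjoinRoot g ≃ AdjoinRoot g₁ × AdjoinRoot g₂`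
  let e₀ : AdjoinRoot g ≃+* AdjoinRoot g₁ × AdjoinRoot g₂ :=
    (Ideal.quotEquivOfEq hspan).trans (Ideal.quotientInfEquivQuotientProd _ _ hIJ)
  have he₀ : ∀ p : ℝ[X], e₀ (AdjoinRoot.mk g p) = (AdjoinRoot.mk g₁ p, AdjoinRoot.mk g₂ p) := by
    intro p
    refine Prod.ext ?_ ?_
    · change (Ideal.quotientInfEquivQuotientProd _ _ hIJ (Ideal.quotEquivOfEq hspan
        (Ideal.Quotient.mk _ p))).fst = _
      rw [Ideal.quotientInfEquivQuotientProd_fst, Ideal.quotEquivOfEq_mk, Ideal.Quotient.factor_mk]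
      rfl
    · change (Ideal.quotientInfEquivQuotientProd _ _ hIJ (Ideal.quotEquivOfEq hspan
        (Ideal.Quotient.mk _ p))).snd = _
      rw [Ideal.quotientInfEquivQuotientProd_snd, Ideal.quotEquivOfEq_mk, Ideal.Quotient.factor_mk]
      rfl
  let e : AdjoinRoot g ≃ₐ[ℝ] AdjoinRoot g₁ × AdjoinRoot g₂ :=
    AlgEquiv.ofRingEquiv (f := e₀) fun r => by
      rw [AdjoinRoot.algebraMap_eq, ← AdjoinRoot.mk_C, he₀]
      rfl
  obtain ⟨p, rfl⟩ := AdjoinRoot.mk_surjective u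
  refine ⟨AdjoinRoot.mk g₁ p, AdjoinRoot.mk g₂ p, ?_⟩
  rw [← Algebra.trace_eq_of_algEquiv e, map_mul, Algebra.trace_prod_apply]
  change Algebra.trace ℝ _ ((e₀ (AdjoinRoot.mk g p) * e₀ (AdjoinRoot.mk g p)).fst) +
      Algebra.trace ℝ _ ((e₀ (AdjoinRoot.mk g p) * e₀ (AdjoinRoot.mk g p)).snd) = _
  rw [he₀, Prod.fst_mul, Prod.snd_mul]

/-- **Sylvester–Hermite, positive semidefinite direction** ([Hanselka2017, Lemma 1.1 and
Cor. 3.1], over `ℝ`): if `g ∈ ℝ[t]` is monic with all roots real — `card g.roots = deg g` — then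
the trace form of `ℝ[t]/(g)` over `ℝ` is positive semidefinite: `Tr(u²) ≥ 0` for all `u`
(indeed `Tr(u²) = Σ_λ m_λ u(λ)²`). [cite: Hanselka2017, Lemma 1.1 (Sylvester) and Cor. 3.1] -/
theorem trace_mul_self_nonneg_of_card_roots_eq {g : ℝ[X]} (hg : g.Monic)
    (hroots : Multiset.card g.roots = g.natDegree) (u : AdjoinRoot g) :
    0 ≤ Algebra.trace ℝ (AdjoinRoot g) (u * u) := by
  induction hn : g.natDegree using Nat.strong_induction_on generalizing g with
  | _ n ih =>
  rcases Nat.eq_zero_or_pos n with rfl | hnpos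
  · -- `g = 1`: the zero ring
    have h1 : g = 1 := hg.natDegree_eq_zero.mp hn
    subst h1
    have hsub : Subsingleton (AdjoinRoot (1 : ℝ[X])) := by
      refine ⟨fun a b => ?_⟩
      obtain ⟨p, rfl⟩ := AdjoinRoot.mk_surjective a
      obtain ⟨q, rfl⟩ := AdjoinRoot.mk_surjective b
      rw [AdjoinRoot.mk_eq_mk]
      exact one_dvd _
    rw [Subsingleton.elim (u * u) 0, map_zero]
  · -- a root `c` of multiplicity `m`, `g = (t - c)^m h`
    have hg0 : g ≠ 0 := hg.ne_zero
    have hne : g.roots ≠ 0 := by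
      intro h0
      rw [h0, Multiset.card_zero] at hroots
      omega
    obtain ⟨c, hc⟩ := Multiset.exists_mem_of_ne_zero hne
    set m := g.rootMultiplicity c with hm
    set h := g /ₘ (X - C c) ^ m with hh
    have hdec : (X - C c) ^ m * h = g := pow_mul_divByMonic_rootMultiplicity_eq g c
    have hhc : h.eval c ≠ 0 := eval_divByMonic_pow_rootMultiplicity_ne_zero c hg0
    have hmpos : 0 < m := (rootMultiplicity_pos hg0).mpr (isRoot_of_mem_roots hc)
    have hmon₁ : ((X - C c) ^ m).Monic := (monic_X_sub_C c).pow m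
    have hmon₂ : h.Monic := hmon₁.of_mul_monic_left (hdec ▸ hg)
    have hcop : IsCoprime ((X - C c) ^ m) h := by
      refine IsCoprime.pow_left ((irreducible_X_sub_C c).coprime_iff_not_dvd.mpr ?_)
      rw [dvd_iff_isRoot]
      exact hhc
    -- degrees and roots of `h`
    have hdeg : g.natDegree = m + h.natDegree := by
      rw [← hdec, hmon₁.natDegree_mul hmon₂, natDegree_pow, natDegree_X_sub_C, mul_one]
    have hrootsh : Multiset.card h.roots = h.natDegree := by
      have hr : g.roots = m • {c} + h.roots := by
        rw [← hdec, roots_mul (hdec.symm ▸ hg0), roots_pow, roots_X_sub_C]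
      have := hroots
      rw [hr, Multiset.card_add, Multiset.card_nsmul, Multiset.card_singleton, mul_one, hdeg] at this
      omega
    have hlt : h.natDegree < n := by omega
    obtain ⟨u₁, u₂, htr⟩ := trace_mul_self_eq_add_of_isCoprime hmon₁ hmon₂ hcop hdec u
    rw [htr]
    exact add_nonneg (trace_mul_self_nonneg_local c m u₁) (ih _ hlt hmon₂ hrootsh u₂ rfl)

end Literature.FieldTheory.RealClosed
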